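import Mathlib.Analysis.InnerProductSpace.PiL2
import Mathlib.Tactic
import HarnessLib

/-!
# Crux `BondOrderTwelve` (stmt-AtomisticToContinuum-12079, route `TwoCentreKissingKernel`), line
# `birth` — stub `stub_shellProjection`

Stub 1b of the lead skeleton (elementary radial projection).  ASSUMING the unit-vector soft kissing
bound `H` (every finite set of unit vectors of `ℝ³` with pairwise inner products `≤ 251/500` has at
most twelve elements — the neighbouring stub `stub_softKissingUnit`, taken here as a HYPOTHESIS), at
most twelve points lie in the spherical shell `(1-10⁻³)a ≤ |p - c| ≤ (1+10⁻³)a` about a centre `c`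
with mutual distances `≥ (1-10⁻³)a`.

Proof.  Project radially, `u p := ‖p - c‖⁻¹ • (p - c)`.  For `p` in the shell `R := ‖p - c‖ > 0`, so
`‖u p‖ = 1`.  For distinct `p, q` in the shell with `R := ‖p - c‖`, `S := ‖q - c‖`, `D := ‖p - q‖`,
`2⟪p - c, q - c⟫ = R² + S² - D²` (`norm_sub_sq_real`), hence
`⟪u p, u q⟫ = (R² + S² - D²) / (2RS) ≤ 251/500`, because `R² + S² - D² ≤ (502/500)·R·S` on the box
`R, S ∈ [0.999a, 1.001a]`, `D ≥ 0.999a` (worst corner `R = S = 1.001a`: `0.996·1.002001 = 0.997993 <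
0.998001`; a degree-two Positivstellensatz certificate found by `nlinarith`).  In particular
`⟪u p, u q⟫ ≤ 0.502 < 1 = ⟪u p, u p⟫`, so `u` is injective on the shell set `T`, and
`#T = #(T.image u) ≤ 12` by `H`.
-/

noncomputable section

namespace Summit.AtomisticToContinuum.Crystallization.Theorems.TwoCentreKissingKernelBondOrderTwelve

/-- The real inequality behind the projection: on the box `R, S ∈ [(1-10⁻³)a, (1+10⁻³)a]` with
`D ≥ (1-10⁻³)a` and `a > 0`, `(R² + S² - D²)/2 ≤ (251/500)·R·S`.  Substituting `R = 1.001a - x`,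
`S = 1.001a - y`, `D = 0.999a + e` (`x, y ∈ [0, 0.002a]`, `e ≥ 0`) the difference is
`0.000008004a² + 0.996996a(x+y) + 1.004xy - x² - y² + 1.998ae + e² ≥ 0`, using `x² ≤ 0.002a·x`,
`y² ≤ 0.002a·y`. -/
private theorem shell_inner_bound {a R S D : ℝ} (ha : 0 < a) (hR0 : (1 - 1 / 1000) * a ≤ R)
    (hR1 : R ≤ (1 + 1 / 1000) * a) (hS0 : (1 - 1 / 1000) * a ≤ S)
    (hS1 : S ≤ (1 + 1 / 1000) * a) (hD : (1 - 1 / 1000) * a ≤ D) :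
    (R ^ 2 + S ^ 2 - D ^ 2) / 2 ≤ R * S * (251 / 500) := by
  nlinarith [mul_nonneg (sub_nonneg.2 hR1) (sub_nonneg.2 hR0),
    mul_nonneg (sub_nonneg.2 hS1) (sub_nonneg.2 hS0),
    mul_nonneg (sub_nonneg.2 hR1) (sub_nonneg.2 hS1), mul_nonneg ha.le (sub_nonneg.2 hR1),
    mul_nonneg ha.le (sub_nonneg.2 hS1), mul_nonneg (sub_nonneg.2 hD) (sub_nonneg.2 hD),
    mul_nonneg ha.le (sub_nonneg.2 hD), mul_pos ha ha]

/-- **Stub 1b — shell projection.**  The unit-vector soft kissing bound at inner-product threshold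
`251/500` (hypothesis) gives the shell form: at most twelve points `p` with
`(1-10⁻³)a ≤ dist p c ≤ (1+10⁻³)a` and mutual distances `≥ (1-10⁻³)a`.  Radial projection
`p ↦ ‖p - c‖⁻¹ • (p - c)` is injective on the shell set and lands in unit vectors with pairwise inner
products `(R² + S² - D²)/(2RS) ≤ 251/500`. -/
theorem stub_shellProjection : (∀ T : Finset (EuclideanSpace ℝ (Fin 3)), (∀ v ∈ T, ‖v‖ = 1) → (∀ v ∈ T, ∀ w ∈ T, v ≠ w → inner ℝ v w ≤ (251 / 500 : ℝ)) → T.card ≤ 12) → ∀ a : ℝ, 0 < a → ∀ (c : EuclideanSpace ℝ (Fin 3)) (T : Finset (EuclideanSpace ℝ (Fin 3))), (∀ p ∈ T, (1 - 1 / 1000) * a ≤ dist p c ∧ dist p c ≤ (1 + 1 / 1000) * a) → (∀ p ∈ T, ∀ q ∈ T, p ≠ q → (1 - 1 / 1000) * a ≤ dist p q) → T.card ≤ 12 := by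
  intro H a ha c T hshell hsep
  -- the radial projection about `c`, kept opaque behind its defining equation
  obtain ⟨u, hu⟩ : ∃ u : EuclideanSpace ℝ (Fin 3) → EuclideanSpace ℝ (Fin 3),
      ∀ p, u p = (‖p - c‖)⁻¹ • (p - c) := ⟨_, fun _ => rfl⟩
  have hpos : ∀ p ∈ T, 0 < ‖p - c‖ := fun p hp => by
    have h := (hshell p hp).1
    rw [dist_eq_norm] at h
    linarith
  have hunit : ∀ p ∈ T, ‖u p‖ = 1 := fun p hp => by
    rw [hu p, norm_smul, norm_inv, norm_norm, inv_mul_cancel₀ (hpos p hp).ne']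
  have hkey : ∀ p ∈ T, ∀ q ∈ T, p ≠ q → inner ℝ (u p) (u q) ≤ (251 / 500 : ℝ) := by
    intro p hp q hq hpq
    have hR := hshell p hp
    have hS := hshell q hq
    have hD := hsep p hp q hq hpq
    rw [dist_eq_norm] at hR hS hD
    have hI : inner ℝ (p - c) (q - c) = (‖p - c‖ ^ 2 + ‖q - c‖ ^ 2 - ‖p - q‖ ^ 2) / 2 := by
      have h := norm_sub_sq_real (p - c) (q - c)
      rw [sub_sub_sub_cancel_right] at h
      linarith
    rw [hu p, hu q, real_inner_smul_left, real_inner_smul_right, hI, ← mul_assoc, ← mul_inv,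
      inv_mul_le_iff₀ (mul_pos (hpos p hp) (hpos q hq))]
    exact shell_inner_bound ha hR.1 hR.2 hS.1 hS.2 hD
  have hinj : Set.InjOn u ↑T := by
    intro p hp q hq hpq
    by_contra hne
    have h := hkey p hp q hq hne
    rw [hpq, real_inner_self_eq_norm_sq, hunit q hq] at h
    norm_num at h
  classical
  rw [← Finset.card_image_of_injOn hinj]
  refine H _ ?_ ?_
  · intro v hv
    obtain ⟨p, hp, rfl⟩ := Finset.mem_image.1 hv
    exact hunit p hp
  · intro v hv w hw hvw
    obtain ⟨p, hp, rfl⟩ := Finset.mem_image.1 hv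
    obtain ⟨q, hq, rfl⟩ := Finset.mem_image.1 hw
    exact hkey p hp q hq fun h => hvw (h ▸ rfl)

end Summit.AtomisticToContinuum.Crystallization.Theorems.TwoCentreKissingKernelBondOrderTwelve

end
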